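import Summits.Ventures.CertifiedArithmetic.LowPrec.GemmThetaLawGenMixBData

/-!
# E3M2×E2M1 law check, binades 8, 9

HONEST FRAMING (venture CertifiedArithmetic / cell `pub-lowprec`, seat gemm, gen 12 → 13): certified
error envelopes and provably optimal rounding/accumulation schemes for low-precision formats under
stated cost models; every table by two implementations; no hardware or vendor claims.

Part 5/6 of the per-level kernel check of `e3m2e2m1Law.lawCheck` (see `GemmThetaLawGenMixBData.lean`):
levels `bin 8`, `bin 9` (878 + 808 classes). [cell]
-/

namespace Literature.ComputerArithmetic.FloatingPoint

namespace MiniFloat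

namespace ThetaLaw

/-- Level `bin 8` of the E3M2×E2M1 law check passes (878 classes, both signs, all 143 letters).
[cell, kernel `decide`] -/
theorem levCheck_e3m2e2m1_b8 : e3m2e2m1Law.levCheck (Lev.bin 8) = true := by
  decide +kernel

/-- Level `bin 9` of the E3M2×E2M1 law check passes (808 classes, both signs, all 143 letters).
[cell, kernel `decide`] -/
theorem levCheck_e3m2e2m1_b9 : e3m2e2m1Law.levCheck (Lev.bin 9) = true := by
  decide +kernel

end ThetaLaw

end MiniFloat

end Literature.ComputerArithmetic.FloatingPoint
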